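import Summits.QuantumFields.YangMills.Theorems.BalabanLadderIRHeavyTwistWallWindow
import Summits.QuantumFields.YangMills.Theorems.BalabanLadderIRTwistCostOfPurity
import Summits.QuantumFields.YangMills.Theorems.ConvexGribovBodyBrascampLiebVacuumSCDimensionGapSU2
import Literature.MathematicalPhysics.QuantumLattice.GaugeGroups
import HarnessLib

/-!
# THE HEAVY-TWIST WALL at `SU(2)` (rung 2, EVEN boxes): the linear deconfinement twist window `TwistWindowSU2 204 (9/10)` and
# its consequences for the seed `E(θ)` of `BalabanLadder.IR` — UNCONDITIONAL

Wall seat `ym-ir-wall-p1` (explicit unit R422a; recipe ym-ir-crit-3 2026-08-28T07:11:56Z; owner of the line: ym-ir-idea-10 `heavy-twist`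
§3b; suppliers: ym-ir-lit-4 (Literature parts 4–6), ym-ir-idea-9 (S1 `half_twist_cost_le_coldDefect`), ym-ir-idea-2 (O10 sector Cauchy–Schwarz);
engine `twistRatio_le_of_rate` of `BalabanLadderIRHeavyTwistWallWindow`).  Everything below is PROVED from tree theorems; NO physics stub,
NO Laplace method; axioms ⊆ {propext, Classical.choice, Quot.sound}.

* `su2_trace_im_eq_zero` — `SU(2)` has real characters; `su2_*_of_coe_eq_neg_one` — the centre element `−1` (membership `−1 ∈ SU(2)` is the tree's `BrascampLiebVacuumSC.DimensionGapSU2.neg_one_mem`).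
* `borgsSeilerRate_two_le` — on the LINEAR window `204·T ≤ β`: `f = (1 + 4/β)^T − 1 ≤ 1/50` (Bernoulli).
* `twistRatio_SU2_le` (**the window**): for every `c ∈ SU(2)` with `↑c = −1`, every `L ≥ 8` with `Even L` and every `β` with
  `204·⌊L/4⌋ ≤ β`:  `Z^{(c on (0,3))}_β(L,L,L,⌊L/4⌋) / Z_β(L,L,L,⌊L/4⌋) ≤ 9/10` (fundamental representation);
  `twistWindow_SU2` — the same packaged in the SHAPE OF RECORD `0 < 204 ∧ 9/10 < 1 ∧ ∃ β₀, ∀ β ≥ β₀, ∀ L ≥ 8, Even L → 204·⌊L/4⌋ ≤ β → r ≤ 9/10`,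
  i.e. definitionally idea-10's `TwistWindowSU2 204 (9/10)` (`Cruxes/IR/Lines/heavy_twist.lean` rev 5 / landable rev 4, where
  `twistRatio`/`twistedColdZ`/`minusOneSU2` unfold to the terms used here); their `not_uniformExit24_of_windowSU2` turns it into the
  parity-free headline `¬ UniformExit24` once that file is in the tree.
* `coldDefect_ge_of_even_window` — with S1: every EVEN cold box `L ≥ 8` in the window has purity defect `δᶜ_β(L) ≥ 1/20`.
* `even_selector_outgrows` (**headline 1**) — for `θ < 1/20` (∋ `1/24`) every exit selector `β ↦ L(β)` of `E(θ)` at `SU(2)` (boxes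
  `L(β) ≥ 8`, `θ`-pure eventually) satisfies eventually: `L(β)` is ODD or `L(β) > β/51`.
* `no_uniform_even_exit` (**headline 2**) — for `θ < 1/20` NO even box `L ≥ 8` is `θ`-pure at all large `β` («`¬ UniformExitAt θ` on
  even boxes»).

HONEST FRAMING.  This is a NEGATIVE / WALL theorem about the SHAPE of the seed `E(θ) = BasinRung.ColdExitAt θ`: width 0 toward `IR`/`IRcof`;
it proves neither `BalabanLadder.IR`, nor `E`, nor S2 (`HeavyTwistSU2`), nor anything on odd boxes, nor the Yang–Mills mass gap (Clay); R4 closes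
only `BalabanLadder.UV`.  Mechanism KNOWN (Borgs–Seiler 1983 II.6–II.8 + III.6; Tomboulis–Yaffe 1985); novelty none claimed.
-/

set_option autoImplicit false

noncomputable section

open MeasureTheory Filter Topology
open Literature.MathematicalPhysics.QuantumFieldTheory Literature.MathematicalPhysics.QuantumLattice Literature.Barriers.QuantumFields
open Summit.QuantumFields.YangMills.Cruxes.IR.ColdPurityBridge (coldDefect)

namespace Summit.QuantumFields.YangMills.Cruxes.IR.HeavyTwistWall

/-! ## `SU(2)`: real characters and the centre element `−1` -/

/-- **`SU(2)` has real characters**: `Im tr U = 0` (`U⁻¹ = U^† = adj U` for `det U = 1`, so `Ū₁₁ = U₀₀`). -/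
theorem su2_trace_im_eq_zero (U : Matrix.specialUnitaryGroup (Fin 2) ℂ) :
    ((fundamentalRep (Fin 2)) U).trace.im = 0 := by
  obtain ⟨A, hA⟩ := U
  have hU : A ∈ Matrix.unitaryGroup (Fin 2) ℂ := hA.1
  have hdet : A.det = 1 := hA.2
  have hstar : star A * A = 1 := Matrix.mem_unitaryGroup_iff'.1 hU
  have hinv : A⁻¹ = star A := Matrix.inv_eq_left_inv hstar
  have hadj : A⁻¹ = A.adjugate := by rw [Matrix.inv_def, hdet]; simp
  have h11 : (star A) 1 1 = A 0 0 := by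
    rw [← hinv, hadj, Matrix.adjugate_fin_two]; simp
  have hc : starRingEnd ℂ (A 1 1) = A 0 0 := by
    rw [← h11, Matrix.star_apply]; rfl
  show (A.trace).im = 0
  rw [Matrix.trace_fin_two, ← hc]
  simp

/-- An element of `SU(2)` whose matrix is `−1` is central. -/
theorem su2_mem_center_of_coe_eq_neg_one {c : Matrix.specialUnitaryGroup (Fin 2) ℂ}
    (hc : (c : Matrix (Fin 2) (Fin 2) ℂ) = -1) : c ∈ Subgroup.center (Matrix.specialUnitaryGroup (Fin 2) ℂ) := by
  rw [Subgroup.mem_center_iff]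
  intro g
  apply Subtype.ext
  show (g : Matrix (Fin 2) (Fin 2) ℂ) * c = c * g
  rw [hc]; simp

/-- … squares to `1`. -/
theorem su2_mul_self_of_coe_eq_neg_one {c : Matrix.specialUnitaryGroup (Fin 2) ℂ}
    (hc : (c : Matrix (Fin 2) (Fin 2) ℂ) = -1) : c * c = 1 := by
  apply Subtype.ext
  show (c : Matrix (Fin 2) (Fin 2) ℂ) * c = 1
  rw [hc]; simp

/-- … and is represented by `−1` in the fundamental representation. -/
theorem fundamentalRep_of_coe_eq_neg_one {c : Matrix.specialUnitaryGroup (Fin 2) ℂ}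
    (hc : (c : Matrix (Fin 2) (Fin 2) ℂ) = -1) : fundamentalRep (Fin 2) c = -1 := hc

/-! ## The numbers: `f ≤ 1/50` on the linear window, and the bound `≥ 1/10` -/

/-- **Borgs–Seiler's rate on the linear window**: for `β > 0` and `204·T ≤ β`, `(1 + 4/β)^T − 1 ≤ 1/50`
(`(1 + 4/β)^{−T} = (1 − 4/(β+4))^T ≥ 1 − 4T/(β+4)` by Bernoulli, and `4T/(β+4) ≤ 1/51`). -/
theorem borgsSeilerRate_two_le {β : ℝ} (hβ : 0 < β) {T : ℕ} (hT : (204 : ℝ) * T ≤ β) :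
    borgsSeilerRate 2 T β ≤ 1 / 50 := by
  unfold borgsSeilerRate
  have hq : (1 : ℝ) + 2 * (2 : ℕ) / β = (β + 4) / β := by push_cast; field_simp; ring
  rw [hq]
  have hb4 : 0 < β + 4 := by linarith
  -- Bernoulli for the inverse base `β/(β+4) = 1 + (−4/(β+4))`
  have hbern : 1 + (T : ℝ) * (-4 / (β + 4)) ≤ (1 + -4 / (β + 4)) ^ T :=
    one_add_mul_le_pow (by rw [le_div_iff₀ hb4]; linarith) T
  have hbase : (1 : ℝ) + -4 / (β + 4) = β / (β + 4) := by field_simp; ring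
  rw [hbase] at hbern
  have hlow : (50 : ℝ) / 51 ≤ (β / (β + 4)) ^ T := by
    refine le_trans ?_ hbern
    have h4 : 4 * (T : ℝ) / (β + 4) ≤ 1 / 51 := by
      rw [div_le_iff₀ hb4]; linarith
    have : (T : ℝ) * (-4 / (β + 4)) = -(4 * (T : ℝ) / (β + 4)) := by ring
    rw [this]
    linarith
  have hv : ((β + 4) / β) ^ T = ((β / (β + 4)) ^ T)⁻¹ := by
    rw [← inv_pow, inv_div]
  rw [hv]
  have hinv : ((β / (β + 4)) ^ T)⁻¹ ≤ ((50 : ℝ) / 51)⁻¹ := inv_anti₀ (by norm_num) hlow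
  norm_num at hinv ⊢
  linarith

/-- **The window constant**: for `0 ≤ f ≤ 1/50`, `1 − (1 − 5f)²/(2·2²·(1 − 19f/4)) ≤ 9/10`. -/
theorem window_bound_le {f : ℝ} (hf0 : 0 ≤ f) (hf : f ≤ 1 / 50) :
    1 - (1 - 5 * f) ^ 2 / (2 * (2 : ℝ) ^ 2 * (1 - 19 / 4 * f)) ≤ 9 / 10 := by
  have hden : 0 < 2 * (2 : ℝ) ^ 2 * (1 - 19 / 4 * f) := by nlinarith
  have hkey : (1 : ℝ) / 10 ≤ (1 - 5 * f) ^ 2 / (2 * (2 : ℝ) ^ 2 * (1 - 19 / 4 * f)) := by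
    rw [le_div_iff₀ hden]
    nlinarith
  linarith

/-! ## The window at `SU(2)` -/

/-- **THE WINDOW (rung 2 engine at `SU(2)`).**  For every `c ∈ SU(2)` with `↑c = −1`, every EVEN `L ≥ 8` and every `β` in the linear
window `204·⌊L/4⌋ ≤ β`, the temporal `ℤ₂`-twist ratio of the cold box `L³ × ⌊L/4⌋` (fundamental Wilson action) is at most `9/10`:
`Z^{(c on (0,3))}_β(L,L,L,⌊L/4⌋) / Z_β(L,L,L,⌊L/4⌋) ≤ 9/10`. -/
theorem twistRatio_SU2_le (c : Matrix.specialUnitaryGroup (Fin 2) ℂ) (hc : (c : Matrix (Fin 2) (Fin 2) ℂ) = -1) {β : ℝ} {L : ℕ}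
    (hL : 8 ≤ L) (hE : Even L) (hβ : (204 : ℝ) * ((L / 4 : ℕ) : ℝ) ≤ β) :
    wilsonFinTorusTwistedPartition (fundamentalRep (Fin 2)) β
          (Function.update (1 : Fin 4 → Matrix.specialUnitaryGroup (Fin 2) ℂ) 0 c) L L L (L / 4) /
        wilsonFinTorusPartition (fundamentalRep (Fin 2)) β L L L (L / 4) ≤ 9 / 10 := by
  obtain ⟨k, hk⟩ := hE
  obtain ⟨n, hn⟩ : ∃ n, L = n + 1 + n + 1 := ⟨k - 1, by omega⟩
  have hn1 : 1 ≤ n := by omega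
  haveI : NeZero (L / 4) := ⟨by omega⟩
  have hT2 : (2 : ℝ) ≤ ((L / 4 : ℕ) : ℝ) := by exact_mod_cast (show 2 ≤ L / 4 by omega)
  have hβpos : 0 < β := by linarith
  have hf := borgsSeilerRate_two_le hβpos (T := L / 4) hβ
  have hf0 := borgsSeilerRate_nonneg 2 (L / 4) hβpos
  have h5 : 5 * borgsSeilerRate 2 (L / 4) β < 1 := by linarith
  have key := twistRatio_le_of_rate (G := Matrix.specialUnitaryGroup (Fin 2) ℂ) (fundamentalRep (Fin 2))
    (continuous_fundamentalRep (Fin 2)) fundamentalRep_mem_unitaryGroup (fundamentalRep_injective (Fin 2)) (by norm_num)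
    su2_trace_im_eq_zero (su2_mem_center_of_coe_eq_neg_one hc) (fundamentalRep_of_coe_eq_neg_one hc)
    (su2_mul_self_of_coe_eq_neg_one hc) hβpos hn1 (L / 4) h5
  rw [← hn] at key
  simp only [Nat.cast_ofNat] at key
  exact key.trans (window_bound_le hf0 hf)

/-- **The window in the SHAPE OF RECORD** — definitionally ym-ir-idea-10's `TwistWindowSU2 204 (9/10)` (`heavy_twist` §3b rev 5: `0 < κ ∧ ρ < 1 ∧
∃ β₀, ∀ β ≥ β₀, ∀ L ≥ 8, Even L → κ·⌊L/4⌋ ≤ β → twistRatio ≤ ρ` at `κ = 204`, `ρ = 9/10`, twist `c = −1` in the `(0,3)`-planes), stated for every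
`c` with `↑c = −1`. -/
theorem twistWindow_SU2 (c : Matrix.specialUnitaryGroup (Fin 2) ℂ) (hc : (c : Matrix (Fin 2) (Fin 2) ℂ) = -1) :
    (0 : ℝ) < 204 ∧ (9 / 10 : ℝ) < 1 ∧ ∃ β₀ : ℝ, ∀ β : ℝ, β₀ ≤ β → ∀ L : ℕ, 8 ≤ L → Even L →
      (204 : ℝ) * ((L / 4 : ℕ) : ℝ) ≤ β →
        wilsonFinTorusTwistedPartition (fundamentalRep (Fin 2)) β
            (Function.update (1 : Fin 4 → Matrix.specialUnitaryGroup (Fin 2) ℂ) 0 c) L L L (L / 4) /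
          wilsonFinTorusPartition (fundamentalRep (Fin 2)) β L L L (L / 4) ≤ 9 / 10 :=
  ⟨by norm_num, by norm_num, 0, fun _ _ _ hL hE hβ => twistRatio_SU2_le c hc hL hE hβ⟩

/-! ## Consequences for the seed `E(θ)`: the wall on even boxes -/

/-- **Impurity of even boxes in the window** (window + S1 `half_twist_cost_le_coldDefect`): for `c` with `↑c = −1`, EVEN `L ≥ 8` and
`204·⌊L/4⌋ ≤ β`, the cold purity defect of the `SU(2)` box satisfies `δᶜ_β(L) ≥ 1/20`. -/
theorem coldDefect_ge_of_even_window (c : Matrix.specialUnitaryGroup (Fin 2) ℂ) (hc : (c : Matrix (Fin 2) (Fin 2) ℂ) = -1) {β : ℝ}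
    {L : ℕ} (hL : 8 ≤ L) (hE : Even L) (hβ : (204 : ℝ) * ((L / 4 : ℕ) : ℝ) ≤ β) :
    (1 : ℝ) / 20 ≤ coldDefect (fundamentalRep (Fin 2)) β L := by
  have hβ0 : 0 ≤ β := le_trans (by positivity) hβ
  have hz : ∀ μ : Fin 4, Function.update (1 : Fin 4 → Matrix.specialUnitaryGroup (Fin 2) ℂ) 0 c μ ∈
      Subgroup.center (Matrix.specialUnitaryGroup (Fin 2) ℂ) := by
    intro μ
    by_cases hμ : μ = 0
    · subst hμ; rw [Function.update_self]; exact su2_mem_center_of_coe_eq_neg_one hc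
    · rw [Function.update_of_ne hμ]; exact Subgroup.one_mem _
  have hS1 := (TwistCost.half_twist_cost_le_coldDefect (ρ := fundamentalRep (Fin 2)) (continuous_fundamentalRep (Fin 2))
    fundamentalRep_mem_unitaryGroup hβ0 hL hz).1
  have hr := twistRatio_SU2_le c hc hL hE hβ
  linarith

/-- **HEADLINE 1 — even exit selectors grow linearly.**  For every `θ < 1/20` (in particular the tolerance of record `1/24`) and every
exit selector `β ↦ L(β)` of `E(θ)` at `SU(2)` (fundamental representation; `L(β) ≥ 8` and `θ`-pure for all large `β`): eventually in `β`,
`L(β)` is ODD or `L(β) > β/51`. -/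
theorem even_selector_outgrows {θ : ℝ} (hθ : θ < 1 / 20) (Lsel : ℝ → ℕ) (h8 : ∀ᶠ β : ℝ in atTop, 8 ≤ Lsel β)
    (hpure : ∀ᶠ β : ℝ in atTop, coldDefect (fundamentalRep (Fin 2)) β (Lsel β) ≤ θ) :
    ∀ᶠ β : ℝ in atTop, Even (Lsel β) → β / 51 < (Lsel β : ℝ) := by
  filter_upwards [h8, hpure] with β h8β hpβ hEβ
  by_contra hle
  push Not at hle
  have h4 : ((Lsel β / 4 : ℕ) : ℝ) ≤ (Lsel β : ℝ) / 4 := Nat.cast_div_le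
  have hw : (204 : ℝ) * ((Lsel β / 4 : ℕ) : ℝ) ≤ β := by linarith
  have h := coldDefect_ge_of_even_window ⟨-1, Summit.QuantumFields.YangMills.Theorems.BrascampLiebVacuumSC.DimensionGapSU2.neg_one_mem⟩ rfl h8β hEβ hw
  linarith

/-- **HEADLINE 2 — no β-uniform EVEN exit below `1/20` («`¬ UniformExitAt θ` on even boxes», `SU(2)`, fundamental representation).**
For `θ < 1/20` there is NO even box `L ≥ 8` that is `θ`-pure at all sufficiently large `β`. -/
theorem no_uniform_even_exit {θ : ℝ} (hθ : θ < 1 / 20) :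
    ¬ ∃ L : ℕ, 8 ≤ L ∧ Even L ∧ ∃ β₁ : ℝ, ∀ β : ℝ, β₁ ≤ β → coldDefect (fundamentalRep (Fin 2)) β L ≤ θ := by
  rintro ⟨L, hL, hE, β₁, h⟩
  have h1 := h (max β₁ (204 * ((L / 4 : ℕ) : ℝ))) (le_max_left _ _)
  have h2 := coldDefect_ge_of_even_window ⟨-1, Summit.QuantumFields.YangMills.Theorems.BrascampLiebVacuumSC.DimensionGapSU2.neg_one_mem⟩ rfl hL hE (le_max_right β₁ _)
  linarith

/-- The same for the bundled `fundamentalLatticeRep 2` of the class `E` quantifies over (its `ρ` is `fundamentalRep (Fin 2)` by `rfl`). -/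
theorem no_uniform_even_exit_latticeRep {θ : ℝ} (hθ : θ < 1 / 20) :
    ¬ ∃ L : ℕ, 8 ≤ L ∧ Even L ∧ ∃ β₁ : ℝ, ∀ β : ℝ, β₁ ≤ β → coldDefect (fundamentalLatticeRep 2).ρ β L ≤ θ :=
  no_uniform_even_exit hθ

end Summit.QuantumFields.YangMills.Cruxes.IR.HeavyTwistWall

end
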